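import Summits.QuantumFields.BalabanUV.Beta.CombMixedT2EvenStoreyTwo
import Summits.QuantumFields.BalabanUV.Beta.CompositeOneShotJets
import Summits.QuantumFields.BalabanUV.Beta.CompositeVertexKernelLiftKernel

/-!
# `BalabanUV.Beta.CombMixedT2EvenStoreyTwoPeriodised` — binder row D1 ∕ (C1), PART 31a: **THE COARSE-SLOT-PERIODISED EVEN COMPOSITE MIXED TABLE OF DEPTH 2 —
# LETTERS, PERIOD COVARIANCE, WINDOWS, AND THE LATTICE CONTRACTION PER COPY** (the torus realisation of PART 30's storeywise (K2b) is PART 31b∕c∕d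
# `CombMixedT2EvenStoreyTwoCopies ∕ …Torus ∕ …TorusRow`; this file is the family half, the depth-2 twin of PART 26 `CombMixedT2EvenPeriodised` §1–§2)

WHY (journal [AN2-G70-A3]∕[AN2-G70-A4], road FP g46 A-3 «storeywise RESHAPE WANTED», J-NOTE-14 §5 `HOME/b2b-balaban-beta-an2/gen70/J14-K2B-STOREYWISE.md`).  v5∕v6's smallest
instance `n = 0` of road FP's `hK2b` row is composite depth 2: the mixed table is `M2Of 3 (Lc²) (tabsComp 2 …).mixFF 0 = wM2 • compMix ρ_c Lc 2` (F6d `tabsComp_mixFF`), its torus member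
`ℳ̂₂ᵉ(b,β) := (perF M (dper M (Σ'_n M2ᵉ b.2 ↑b.1 β.2 (β.1 + M′∘n))))|ff` (PART 24's currency: fine bond `b` on the torus of the box `M = Lc²·M′`, coarse multiplier bond `β` at level 2,
its COARSE-period copies summed).  PART 30 computed the lattice Ward row of the even composite table at depth 2 (two storeys, each its own commutator); Engine C TIER V-A∕B showed by
value that the displayed single-commutator form fails at depth 2 (γ = −1 storeywise).  This file carries PART 30 to the periodised family: per copy of the coarse bond the lattice
contraction with a pure gauge is PART 30's two-storey word (§3), the copies come out of the contraction (§2), and the torus contraction IS the lattice contraction with the periodic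
indicator (PART 31b §4 — an2 g42's period-lattice engine `CombWilsonT2Periodised.sum_tgrad_mul_dper_of_indexLaw_periodCov` stopped before the index law, which at depth 2 is
no longer of the engine's single-commutator `hlaw` shape).

WHAT (`d = 3`, centred root `ρ_c = ctr 4 Lc = toSite (ctrOff 4 Lc)`, an1's (0.4)-SYM bricks at both levels, weight `wM2 3 L₂ j` free; [folklore] re-indexing of finitely supported sums
BY NAME; no `def`, no `def … : Prop`, nothing cited, 0 sorry):
* §1 letters of `M2ᵉ κ u ρ′ w := ½•(M2Of 3 L₂ (compMix (ctrOff 4 Lc) Lc 2) j κ u ρ′ w + sgnK (trK (…)))` on `(inl, inl)`: `compMix_inl_inl` (`rfl` to F6c's `compMixKer`), the entry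
  `compMixedT2_even_inl_inl`, the three WINDOWS `winF (Lc²) (wid Lc 2) w` (F6c `compMixKer_eq_zero_bg ∕ _left ∕ _right`), the cube letters `…_of_not_mem_T ∕ _S` uniform over the
  coarse bond, and the joint block covariance `compMixedT2_even_translate` (F6d `compMix_hmixt`).
* §2 the family `hV : V = fun κ u x z a c => Σ'_n M2ᵉ κ u ρ′ (translate M′ w n) x z a c`: `summable_compMixedT2_even_translate_inl_inl` (F6a″ `mem_piFinset_of_mem_winF`),
  **`compMixedT2per_even_periodCov`** (`M = Lc²·M′`), the windows `hT ∕ hS`, and **`tsum_sum_dz_mul_compMixedT2per_even_inl_inl`** (the copy sum comes out of the lattice contraction).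
* §3 **`tsum_sum_dz_mul_compMixedT2_even_inl_inl`** — PART 30 `tsum_sum_grad_mul_compMixKer_two_even` in the table's letters:
  `Σ'_u Σ_κ (λ(u+e_κ) − λ u)·M2ᵉ κ u ρ′ y x z (inl α) (inl γ) = wM2 · (TOP(y;λ;x,z) + (λ z − λ x)·LOW(y;x,z))`,
  `TOP = Σ_{b₁b₂ ∈ win y} (λ(root b₂) − λ(root b₁))·h(ρ′,y;b₁,b₂)·ℓ(b₁;(α,x))·ℓ(b₂;(γ,z))`, `LOW = Σ_{b ∈ win y} ℓ(ρ′,y;b)·h(b;(α,x),(γ,z))`, `root (κ, Lc•y+e) = Lc•(Lc•y+e) + ρ_c`.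
WHAT THIS IS NOT: not the engine ∕ copies ∕ torus fold (PART 31b∕c `CombMixedT2EvenStoreyTwoCopies ∕ …Torus`) nor the matrix row (PART 31d `…TorusRow`); not depth ≥ 3; not (J-R₂) nor v7's display (the road's); nothing of Bałaban's asserted, valued or discharged;
0 estimates; 0∕4 row-D1 binders (hW, hR, D1Tel, D1Rep); ROOT M‴ p325680 ∕ P5c ∕ D6 untouched; NOT (C1), NOT (T-ID), NOT D1, NEVER «G-an2-4 closed», NOT BetaPertH, NOT continuum, NOT Clay.

HONEST DEPENDENCY (page 1, mandatory): continuum YM on T⁴ ⇐ BetaPertH ∧ nine spine estimates (0/9 proved); BetaPertH ⇐ (D1) ∧ (D4) ∧ CAP+tail;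
G-an2-4 gates asym, D1 and NE2/3/4.  HONEST FRAMING (cell contract, verbatim): «discharging `BetaPertH` makes Bałaban's UV stability UNCONDITIONAL —
a real constructive-QFT result; it is NOT the continuum limit and NOT the Clay problem.»  ABSOLUTE RULE (cell charter, verbatim): «No internally-minted
statement may enter as a cited fact. Every hypothesis is either kernel-proved in this package or a verbatim quotation of a PUBLISHED theorem with page
reference. The manuscript(s) under audit are NOT citable for their own disputed steps — they are the thing under adjudication; programme-internal
(2001/route/tribunal) claims are never citable.»  Row D1 ∕ (C1) OWNER an2 (b2b-balaban-beta-an2) gen 71, 2026-08-28.  §1∕§2 shaped on PART 26 §1∕§2; §4 adapted from an2 g42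
`CombWilsonT2Periodised` §1.  No existing file touched.
-/

noncomputable section

open scoped BigOperators

namespace Summit.QuantumFields.BalabanUV.Beta.CombMixedT2EvenStoreyTwoPeriodised

open Finset Matrix
open Literature.MathematicalPhysics.QuantumFieldTheory
open Literature.MathematicalPhysics.QuantumFieldTheory.Balaban1983to89
open Literature.MathematicalPhysics.QuantumFieldTheory.Balaban1983to89.Beta
open B4TorusKernel.MultiPeriod (translate translate_apply)
open B4Reflection242 (translate_translate)
open B6Lemma24Torus (pbox mem_pbox)
open ExpKernelCalculus (MKer shiftK)
open AffineAveraging (Site box toSite unitVec dz)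
open AveragingContoursRooted (ctr ctrOff ctrOff_mem_box)
open AveragingHessianKernels (Bond Near)
open OneStepResolventKernel (Fib)
open BalabanStepW2 (M2Of wM2)
open Summit.QuantumFields.BalabanUV.Beta.TameKernelCalculus (trK trK_apply)
open Summit.QuantumFields.BalabanUV.Beta.BorderedHessian (sgnK sgnK_apply sgnF_inl)
open Summit.QuantumFields.BalabanUV.Beta.AxialDressingRooted (one_le_of_neZero)
open Summit.QuantumFields.BalabanUV.Beta.WardLocusParityLevels (M2Of_apply)
open Summit.QuantumFields.BalabanUV.Beta.SymAveragingHessianCounts (symLinKerAt symVhKerAt symHessKerAt)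
open Summit.QuantumFields.BalabanUV.Beta.SymAveragingMixedJetTables (symMixKerAt)
open Summit.QuantumFields.BalabanUV.Beta.CompositeVertexKernelRec (offs winF wid mem_winF_iff)
open Summit.QuantumFields.BalabanUV.Beta.CompositeVertexKernelLiftKernel (mem_piFinset_of_mem_winF)
open Summit.QuantumFields.BalabanUV.Beta.CompositeMixedTable (compMixKer compMixKer_eq_zero_bg compMixKer_eq_zero_left compMixKer_eq_zero_right)
open Summit.QuantumFields.BalabanUV.Beta.CompositeOneShotJets (compMix compMix_hmixt)
open Summit.QuantumFields.BalabanUV.Beta.CombMixedT2EvenStoreyTwo (tsum_sum_grad_mul_compMixKer_two_even)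
open Summit.QuantumFields.BalabanUV.Beta.FP.KernelPeriodisationFib (Idx perF perF_apply perZ perZ_apply translate_eq_add)
open Summit.QuantumFields.BalabanUV.Beta.FP.KernelPeriodisationFibLoc (dper dper_apply)
open Summit.QuantumFields.BalabanUV.Beta.FP.KernelPeriodisationFibTrace (tsum_sites_eq_sum_tsum)
open Summit.QuantumFields.BalabanUV.Beta.FP.TorusGaugeCovariance (tdelta tdelta_translate tgrad tgrad_inl)
open Summit.QuantumFields.BalabanUV.Beta.FP.PeriodisedBorderIndexWard (translate_injective)
open Summit.QuantumFields.BalabanUV.Beta.FP.PeriodisedBorderTables (translate_eq_add_smul)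
open Summit.QuantumFields.BalabanUV.Beta.CombWilsonT2Periodised (dper_apply_of_periodCov translate_eq_translate_sub_add)

variable {Lc : ℕ} [NeZero Lc]

/-! ## §1 Letters of the even COMPOSITE mixed table of depth 2 on the `(inl, inl)` block: entry, windows, geometry, covariance -/

section Letters

variable (L₂ j : ℕ)

omit [NeZero Lc] in
/-- [folklore] the packed composite mixed table's field–field entries ARE the composite mixed kernel over an1's sym bricks at the centred root (`rfl`;
`toSite (ctrOff 4 Lc) = ctr 4 Lc`). -/
theorem compMix_inl_inl (m : ℕ) (κ : Fin (3 + 1)) (u : Site (3 + 1)) (ρ' : Fin (3 + 1)) (w x z : Site (3 + 1)) (α γ : Fin (3 + 1)) :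
    compMix (ctrOff (3 + 1) Lc) Lc m κ u ρ' w x z (Sum.inl α) (Sum.inl γ)
      = compMixKer (fun _ => symLinKerAt (ctr 4 Lc) Lc) (fun _ => symVhKerAt (ctr 4 Lc) Lc) (fun _ => symHessKerAt (ctr 4 Lc) Lc)
          (fun _ => symMixKerAt (ctr 4 Lc) Lc) Lc m ρ' w (κ, u) (α, x) (γ, z) := rfl

omit [NeZero Lc] in
/-- [folklore] **THE `(inl α, inl γ)` ENTRY OF THE EVEN COMPOSITE MIXED TABLE** (depth 2, weight index `j` at blocking `L₂`):
`M2ᵉ κ u ρ′ w x z (inl α) (inl γ) = wM2 L₂ j · ½·(compMix₂(ρ′,w;(κ,u))(x,z)_{αγ} + compMix₂(ρ′,w;(κ,u))(z,x)_{γα})` (`M2Of_apply`, `sgnF (inl ·) = 1`). -/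
theorem compMixedT2_even_inl_inl (κ : Fin (3 + 1)) (u : Site (3 + 1)) (ρ' : Fin (3 + 1)) (w x z : Site (3 + 1)) (α γ : Fin (3 + 1)) :
    ((1 / 2 : ℝ) • (M2Of 3 L₂ (compMix (ctrOff (3 + 1) Lc) Lc 2) j κ u ρ' w + sgnK (trK (M2Of 3 L₂ (compMix (ctrOff (3 + 1) Lc) Lc 2) j κ u ρ' w)))) x z
        (Sum.inl α) (Sum.inl γ)
      = wM2 3 L₂ j * ((1 / 2 : ℝ) * (compMix (ctrOff (3 + 1) Lc) Lc 2 κ u ρ' w x z (Sum.inl α) (Sum.inl γ)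
          + compMix (ctrOff (3 + 1) Lc) Lc 2 κ u ρ' w z x (Sum.inl γ) (Sum.inl α))) := by
  simp only [Pi.smul_apply, Pi.add_apply, smul_eq_mul, sgnK_apply, trK_apply, sgnF_inl, M2Of_apply, one_mul]
  ring

omit [NeZero Lc] in
/-- [folklore] LEFT-LEG WINDOW of the composite mixed table (F6c `compMixKer_eq_zero_left`): zero unless `x ∈ winF (Lc²) (wid Lc 2) w`. -/
theorem compMix_inl_inl_eq_zero_of_left (κ : Fin (3 + 1)) (u : Site (3 + 1)) (ρ' : Fin (3 + 1)) (w : Site (3 + 1)) {x : Site (3 + 1)}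
    (hx : x ∉ winF (Lc ^ 2) (wid Lc 2) w) (z : Site (3 + 1)) (α γ : Fin (3 + 1)) :
    compMix (ctrOff (3 + 1) Lc) Lc 2 κ u ρ' w x z (Sum.inl α) (Sum.inl γ) = 0 := by
  rw [compMix_inl_inl]
  exact compMixKer_eq_zero_left 2 (κ, u) (f := (α, x)) (γ, z) hx

omit [NeZero Lc] in
/-- [folklore] RIGHT-LEG WINDOW (F6c `compMixKer_eq_zero_right`): zero unless `z ∈ winF (Lc²) (wid Lc 2) w`. -/
theorem compMix_inl_inl_eq_zero_of_right (κ : Fin (3 + 1)) (u : Site (3 + 1)) (ρ' : Fin (3 + 1)) (w x : Site (3 + 1)) {z : Site (3 + 1)}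
    (hz : z ∉ winF (Lc ^ 2) (wid Lc 2) w) (α γ : Fin (3 + 1)) :
    compMix (ctrOff (3 + 1) Lc) Lc 2 κ u ρ' w x z (Sum.inl α) (Sum.inl γ) = 0 := by
  rw [compMix_inl_inl]
  exact compMixKer_eq_zero_right 2 (κ, u) (α, x) (f' := (γ, z)) hz

omit [NeZero Lc] in
/-- [folklore] FINE-BOND WINDOW (F6c `compMixKer_eq_zero_bg`): zero unless `u ∈ winF (Lc²) (wid Lc 2) w`. -/
theorem compMix_inl_inl_eq_zero_of_bond (κ : Fin (3 + 1)) {u : Site (3 + 1)} (ρ' : Fin (3 + 1)) (w : Site (3 + 1))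
    (hu : u ∉ winF (Lc ^ 2) (wid Lc 2) w) (x z : Site (3 + 1)) (α γ : Fin (3 + 1)) :
    compMix (ctrOff (3 + 1) Lc) Lc 2 κ u ρ' w x z (Sum.inl α) (Sum.inl γ) = 0 := by
  rw [compMix_inl_inl]
  exact compMixKer_eq_zero_bg 2 (g := (κ, u)) (α, x) (γ, z) hu

omit [NeZero Lc] in
/-- [folklore] LEFT-LEG WINDOW of the even table's `ff` entries. -/
theorem compMixedT2_even_inl_inl_eq_zero_of_left (κ : Fin (3 + 1)) (u : Site (3 + 1)) (ρ' : Fin (3 + 1)) (w : Site (3 + 1)) {x : Site (3 + 1)}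
    (hx : x ∉ winF (Lc ^ 2) (wid Lc 2) w) (z : Site (3 + 1)) (α γ : Fin (3 + 1)) :
    ((1 / 2 : ℝ) • (M2Of 3 L₂ (compMix (ctrOff (3 + 1) Lc) Lc 2) j κ u ρ' w + sgnK (trK (M2Of 3 L₂ (compMix (ctrOff (3 + 1) Lc) Lc 2) j κ u ρ' w)))) x z
        (Sum.inl α) (Sum.inl γ) = 0 := by
  rw [compMixedT2_even_inl_inl, compMix_inl_inl_eq_zero_of_left κ u ρ' w hx, compMix_inl_inl_eq_zero_of_right κ u ρ' w z hx]
  ring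

omit [NeZero Lc] in
/-- [folklore] RIGHT-LEG WINDOW of the even table's `ff` entries. -/
theorem compMixedT2_even_inl_inl_eq_zero_of_right (κ : Fin (3 + 1)) (u : Site (3 + 1)) (ρ' : Fin (3 + 1)) (w x : Site (3 + 1)) {z : Site (3 + 1)}
    (hz : z ∉ winF (Lc ^ 2) (wid Lc 2) w) (α γ : Fin (3 + 1)) :
    ((1 / 2 : ℝ) • (M2Of 3 L₂ (compMix (ctrOff (3 + 1) Lc) Lc 2) j κ u ρ' w + sgnK (trK (M2Of 3 L₂ (compMix (ctrOff (3 + 1) Lc) Lc 2) j κ u ρ' w)))) x z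
        (Sum.inl α) (Sum.inl γ) = 0 := by
  rw [compMixedT2_even_inl_inl, compMix_inl_inl_eq_zero_of_right κ u ρ' w x hz, compMix_inl_inl_eq_zero_of_left κ u ρ' w hz]
  ring

omit [NeZero Lc] in
/-- [folklore] FINE-BOND (family index) WINDOW of the even table's `ff` entries. -/
theorem compMixedT2_even_inl_inl_eq_zero_of_bond (κ : Fin (3 + 1)) {u : Site (3 + 1)} (ρ' : Fin (3 + 1)) (w : Site (3 + 1))
    (hu : u ∉ winF (Lc ^ 2) (wid Lc 2) w) (x z : Site (3 + 1)) (α γ : Fin (3 + 1)) :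
    ((1 / 2 : ℝ) • (M2Of 3 L₂ (compMix (ctrOff (3 + 1) Lc) Lc 2) j κ u ρ' w + sgnK (trK (M2Of 3 L₂ (compMix (ctrOff (3 + 1) Lc) Lc 2) j κ u ρ' w)))) x z
        (Sum.inl α) (Sum.inl γ) = 0 := by
  rw [compMixedT2_even_inl_inl, compMix_inl_inl_eq_zero_of_bond κ ρ' w hu, compMix_inl_inl_eq_zero_of_bond κ ρ' w hu]
  ring

omit [NeZero Lc] in
/-- [folklore] WINDOW GEOMETRY: two sites of one `winF N W y` window differ by a vector of the cube `Π_i [−W, W]`. -/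
theorem sub_mem_piFinset_of_mem_winF {N W : ℕ} {y x t : Site (3 + 1)} (hx : x ∈ winF N W y) (ht : t ∈ winF N W y) :
    x - t ∈ Fintype.piFinset fun _ : Fin (3 + 1) => Finset.Icc (-(W : ℤ)) (W : ℤ) := by
  rw [Fintype.mem_piFinset]
  intro i
  obtain ⟨h1, h2⟩ := mem_winF_iff.1 hx i
  obtain ⟨h3, h4⟩ := mem_winF_iff.1 ht i
  rw [Finset.mem_Icc, Pi.sub_apply]
  constructor <;> linarith

omit [NeZero Lc] in
/-- [folklore] the even table's `ff` entry at a coarse bond `(ρ′, y)` vanishes unless the fine bond's site lies in the cube window `x − Π_i [−W₂, W₂]` of the LEFT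
fluctuation site (`W₂ = wid Lc 2`; uniform in the coarse bond — the letter `hT` for every copy at once). -/
theorem compMixedT2_even_inl_inl_eq_zero_of_not_mem_T (κ : Fin (3 + 1)) (ρ' : Fin (3 + 1)) (y x z : Site (3 + 1)) (α γ : Fin (3 + 1)) :
    ∀ u ∉ (Fintype.piFinset fun _ : Fin (3 + 1) => Finset.Icc (-(wid Lc 2 : ℤ)) (wid Lc 2 : ℤ)).image (fun v => x - v),
      ((1 / 2 : ℝ) • (M2Of 3 L₂ (compMix (ctrOff (3 + 1) Lc) Lc 2) j κ u ρ' y + sgnK (trK (M2Of 3 L₂ (compMix (ctrOff (3 + 1) Lc) Lc 2) j κ u ρ' y)))) x z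
        (Sum.inl α) (Sum.inl γ) = 0 := fun u hu => by
  by_cases hx : x ∈ winF (Lc ^ 2) (wid Lc 2) y
  · exact compMixedT2_even_inl_inl_eq_zero_of_bond L₂ j κ ρ' y
      (fun hu' => hu (Finset.mem_image.2 ⟨x - u, sub_mem_piFinset_of_mem_winF hx hu', sub_sub_cancel x u⟩)) x z α γ
  · exact compMixedT2_even_inl_inl_eq_zero_of_left L₂ j κ u ρ' y hx z α γ

omit [NeZero Lc] in
/-- [folklore] … and unless the RIGHT fluctuation site lies in the same cube window of the left one (the letter `hS` for every copy at once). -/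
theorem compMixedT2_even_inl_inl_eq_zero_of_not_mem_S (κ : Fin (3 + 1)) (u : Site (3 + 1)) (ρ' : Fin (3 + 1)) (y x : Site (3 + 1)) (α γ : Fin (3 + 1)) :
    ∀ z ∉ (Fintype.piFinset fun _ : Fin (3 + 1) => Finset.Icc (-(wid Lc 2 : ℤ)) (wid Lc 2 : ℤ)).image (fun v => x - v),
      ((1 / 2 : ℝ) • (M2Of 3 L₂ (compMix (ctrOff (3 + 1) Lc) Lc 2) j κ u ρ' y + sgnK (trK (M2Of 3 L₂ (compMix (ctrOff (3 + 1) Lc) Lc 2) j κ u ρ' y)))) x z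
        (Sum.inl α) (Sum.inl γ) = 0 := fun z hz => by
  by_cases hx : x ∈ winF (Lc ^ 2) (wid Lc 2) y
  · exact compMixedT2_even_inl_inl_eq_zero_of_right L₂ j κ u ρ' y x
      (fun hz' => hz (Finset.mem_image.2 ⟨x - z, sub_mem_piFinset_of_mem_winF hx hz', sub_sub_cancel x z⟩)) α γ
  · exact compMixedT2_even_inl_inl_eq_zero_of_left L₂ j κ u ρ' y hx z α γ

omit [NeZero Lc] in
/-- [folklore] **JOINT BLOCK COVARIANCE OF THE EVEN COMPOSITE TABLE** at blocking `Lc²` (F6d `compMix_hmixt`; `sgnK`, `trK`, scalars commute with `shiftK`):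
`M2ᵉ κ (u + Lc²•t) ρ′ (w + t) (x + Lc²•t) (z + Lc²•t) a c = M2ᵉ κ u ρ′ w x z a c`. -/
theorem compMixedT2_even_translate (κ : Fin (3 + 1)) (u : Site (3 + 1)) (ρ' : Fin (3 + 1)) (w t x z : Site (3 + 1)) (a c : Fib 3) :
    ((1 / 2 : ℝ) • (M2Of 3 L₂ (compMix (ctrOff (3 + 1) Lc) Lc 2) j κ (u + ((Lc ^ 2 : ℕ) : ℤ) • t) ρ' (w + t)
        + sgnK (trK (M2Of 3 L₂ (compMix (ctrOff (3 + 1) Lc) Lc 2) j κ (u + ((Lc ^ 2 : ℕ) : ℤ) • t) ρ' (w + t)))))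
        (x + ((Lc ^ 2 : ℕ) : ℤ) • t) (z + ((Lc ^ 2 : ℕ) : ℤ) • t) a c
      = ((1 / 2 : ℝ) • (M2Of 3 L₂ (compMix (ctrOff (3 + 1) Lc) Lc 2) j κ u ρ' w + sgnK (trK (M2Of 3 L₂ (compMix (ctrOff (3 + 1) Lc) Lc 2) j κ u ρ' w)))) x z a c := by
  simp only [Pi.smul_apply, Pi.add_apply, smul_eq_mul, sgnK_apply, trK_apply, M2Of_apply, compMix_hmixt]
  simp only [shiftK, add_neg_cancel_right]

end Letters

/-! ## §2 The coarse-slot-periodised even composite bi-family (depth 2): copies, period covariance, windows -/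

section Family

variable {M M' : Fin (3 + 1) → ℕ} [∀ μ, NeZero (M μ)] [∀ μ, NeZero (M' μ)] (L₂ j : ℕ) (ρ' : Fin (3 + 1)) (w : Site (3 + 1))
  {V : Fin (3 + 1) → Site (3 + 1) → MKer (3 + 1) (Fib 3)}

omit [∀ μ, NeZero (M μ)] in
/-- [folklore] the COARSE-period copies of the multiplier bond whose depth-2 window contains a given fluctuation site are finitely many: on the `(inl, inl)` block
`n ↦ M2ᵉ κ u ρ′ (w + M′∘n) x z (inl α) (inl γ)` is summable (left-leg window; F6a″ `mem_piFinset_of_mem_winF`; `n ↦ w + M′∘n` injective). -/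
theorem summable_compMixedT2_even_translate_inl_inl (κ : Fin (3 + 1)) (u x z : Site (3 + 1)) (α γ : Fin (3 + 1)) :
    Summable fun n : Site (3 + 1) =>
      ((1 / 2 : ℝ) • (M2Of 3 L₂ (compMix (ctrOff (3 + 1) Lc) Lc 2) j κ u ρ' (translate M' w n)
          + sgnK (trK (M2Of 3 L₂ (compMix (ctrOff (3 + 1) Lc) Lc 2) j κ u ρ' (translate M' w n))))) x z (Sum.inl α) (Sum.inl γ) := by
  have hL : 0 < Lc ^ 2 := Nat.pos_of_ne_zero (NeZero.ne _)
  refine summable_of_ne_finset_zero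
    (s := (Fintype.piFinset fun i => Finset.Icc ((x i - (wid Lc 2 : ℤ)) / ((Lc ^ 2 : ℕ) : ℤ)) (x i / ((Lc ^ 2 : ℕ) : ℤ))).preimage _
      (translate_injective (M := M') w).injOn) fun n hn => ?_
  exact compMixedT2_even_inl_inl_eq_zero_of_left L₂ j κ u ρ' _ (fun hx => hn (Finset.mem_preimage.2 (mem_piFinset_of_mem_winF hL hx))) z α γ

omit [NeZero Lc] [∀ μ, NeZero (M μ)] [∀ μ, NeZero (M' μ)] in
/-- [folklore] **JOINT INVARIANCE UNDER THE PERIOD LATTICE OF `M = Lc²·M′`** of the coarse-slot-periodised even composite bi-family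
`V κ u := Σ'_n M2ᵉ κ u ρ′ (w + M′∘n)`: `V κ (u + M∘m) (x + M∘m) (z + M∘m) = V κ u x z` (§1's covariance per copy with `t := M′∘m`, re-indexing `n ↦ n − m`). -/
theorem compMixedT2per_even_periodCov (hM : ∀ i, M i = Lc ^ 2 * M' i)
    (hV : V = fun κ u x z a c => ∑' n : Site (3 + 1),
      ((1 / 2 : ℝ) • (M2Of 3 L₂ (compMix (ctrOff (3 + 1) Lc) Lc 2) j κ u ρ' (translate M' w n)
          + sgnK (trK (M2Of 3 L₂ (compMix (ctrOff (3 + 1) Lc) Lc 2) j κ u ρ' (translate M' w n))))) x z a c)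
    (κ : Fin (3 + 1)) (u m x z : Site (3 + 1)) (a c : Fib 3) :
    V κ (translate M u m) (translate M x m) (translate M z m) a c = V κ u x z a c := by
  subst hV
  show (∑' n : Site (3 + 1), ((1 / 2 : ℝ) • (M2Of 3 L₂ (compMix (ctrOff (3 + 1) Lc) Lc 2) j κ (translate M u m) ρ' (translate M' w n)
          + sgnK (trK (M2Of 3 L₂ (compMix (ctrOff (3 + 1) Lc) Lc 2) j κ (translate M u m) ρ' (translate M' w n))))) (translate M x m) (translate M z m) a c)
      = ∑' n : Site (3 + 1), ((1 / 2 : ℝ) • (M2Of 3 L₂ (compMix (ctrOff (3 + 1) Lc) Lc 2) j κ u ρ' (translate M' w n)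
          + sgnK (trK (M2Of 3 L₂ (compMix (ctrOff (3 + 1) Lc) Lc 2) j κ u ρ' (translate M' w n))))) x z a c
  rw [← (Equiv.subRight m).tsum_eq fun n => ((1 / 2 : ℝ) • (M2Of 3 L₂ (compMix (ctrOff (3 + 1) Lc) Lc 2) j κ u ρ' (translate M' w n)
          + sgnK (trK (M2Of 3 L₂ (compMix (ctrOff (3 + 1) Lc) Lc 2) j κ u ρ' (translate M' w n))))) x z a c]
  refine tsum_congr fun n => ?_
  rw [Equiv.subRight_apply, translate_eq_add_smul hM u m, translate_eq_add_smul hM x m, translate_eq_add_smul hM z m,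
    translate_eq_translate_sub_add M' w n m]
  exact compMixedT2_even_translate L₂ j κ u ρ' (translate M' w (n - m)) (fun i => (M' i : ℤ) * m i) x z a c

omit [NeZero Lc] [∀ μ, NeZero (M μ)] [∀ μ, NeZero (M' μ)] in
/-- [folklore] window letter `hT` (fine bond = family index): on the `(inl, inl)` block `V κ u x z` vanishes unless `u ∈ x − Π_i [−W₂, W₂]`. -/
theorem compMixedT2per_even_inl_inl_eq_zero_of_not_mem_T
    (hV : V = fun κ u x z a c => ∑' n : Site (3 + 1),
      ((1 / 2 : ℝ) • (M2Of 3 L₂ (compMix (ctrOff (3 + 1) Lc) Lc 2) j κ u ρ' (translate M' w n)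
          + sgnK (trK (M2Of 3 L₂ (compMix (ctrOff (3 + 1) Lc) Lc 2) j κ u ρ' (translate M' w n))))) x z a c)
    (κ : Fin (3 + 1)) (x z : Site (3 + 1)) (α γ : Fin (3 + 1)) :
    ∀ u ∉ (Fintype.piFinset fun _ : Fin (3 + 1) => Finset.Icc (-(wid Lc 2 : ℤ)) (wid Lc 2 : ℤ)).image (fun v => x - v),
      V κ u x z (Sum.inl α) (Sum.inl γ) = 0 := fun u hu => by
  subst hV
  exact (tsum_congr fun n => compMixedT2_even_inl_inl_eq_zero_of_not_mem_T L₂ j κ ρ' _ x z α γ u hu).trans tsum_zero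

omit [NeZero Lc] [∀ μ, NeZero (M μ)] [∀ μ, NeZero (M' μ)] in
/-- [folklore] window letter `hS` (right fluctuation leg): on the `(inl, inl)` block `V κ u x z` vanishes unless `z ∈ x − Π_i [−W₂, W₂]`. -/
theorem compMixedT2per_even_inl_inl_eq_zero_of_not_mem_S
    (hV : V = fun κ u x z a c => ∑' n : Site (3 + 1),
      ((1 / 2 : ℝ) • (M2Of 3 L₂ (compMix (ctrOff (3 + 1) Lc) Lc 2) j κ u ρ' (translate M' w n)
          + sgnK (trK (M2Of 3 L₂ (compMix (ctrOff (3 + 1) Lc) Lc 2) j κ u ρ' (translate M' w n))))) x z a c)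
    (κ : Fin (3 + 1)) (u x : Site (3 + 1)) (α γ : Fin (3 + 1)) :
    ∀ z ∉ (Fintype.piFinset fun _ : Fin (3 + 1) => Finset.Icc (-(wid Lc 2 : ℤ)) (wid Lc 2 : ℤ)).image (fun v => x - v),
      V κ u x z (Sum.inl α) (Sum.inl γ) = 0 := fun z hz => by
  subst hV
  exact (tsum_congr fun n => compMixedT2_even_inl_inl_eq_zero_of_not_mem_S L₂ j κ u ρ' _ x α γ z hz).trans tsum_zero

/-- [folklore] **THE COPIES COME OUT OF THE LATTICE CONTRACTION**: for every lattice function `λ` and `ff` entry,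
`Σ'_u Σ_κ (λ(u+e_κ) − λ u)·V κ u x z (inl α) (inl γ) = Σ'_n Σ'_u Σ_κ (λ(u+e_κ) − λ u)·M2ᵉ κ u ρ′ (w + M′∘n) x z (inl α) (inl γ)` — the fine-bond sum is a window sum
(`hT`, uniform over the copies), the copy sum converges termwise (left-leg window), finite sums commute with it. -/
theorem tsum_sum_dz_mul_compMixedT2per_even_inl_inl
    (hV : V = fun κ u x z a c => ∑' n : Site (3 + 1),
      ((1 / 2 : ℝ) • (M2Of 3 L₂ (compMix (ctrOff (3 + 1) Lc) Lc 2) j κ u ρ' (translate M' w n)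
          + sgnK (trK (M2Of 3 L₂ (compMix (ctrOff (3 + 1) Lc) Lc 2) j κ u ρ' (translate M' w n))))) x z a c)
    (lam : Site (3 + 1) → ℝ) (x z : Site (3 + 1)) (α γ : Fin (3 + 1)) :
    ∑' u : Site (3 + 1), ∑ κ : Fin (3 + 1), dz lam κ u * V κ u x z (Sum.inl α) (Sum.inl γ)
      = ∑' n : Site (3 + 1), ∑' u : Site (3 + 1), ∑ κ : Fin (3 + 1), dz lam κ u *
          ((1 / 2 : ℝ) • (M2Of 3 L₂ (compMix (ctrOff (3 + 1) Lc) Lc 2) j κ u ρ' (translate M' w n)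
            + sgnK (trK (M2Of 3 L₂ (compMix (ctrOff (3 + 1) Lc) Lc 2) j κ u ρ' (translate M' w n))))) x z (Sum.inl α) (Sum.inl γ) := by
  set Tx : Finset (Site (3 + 1)) := (Fintype.piFinset fun _ : Fin (3 + 1) => Finset.Icc (-(wid Lc 2 : ℤ)) (wid Lc 2 : ℤ)).image (fun v => x - v) with hTx
  have hT := compMixedT2per_even_inl_inl_eq_zero_of_not_mem_T L₂ j ρ' w hV
  -- the fine-bond sum of the family is a window sum
  rw [tsum_eq_sum (s := Tx) fun u hu => Finset.sum_eq_zero fun κ _ => by rw [hT κ x z α γ u hu, mul_zero]]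
  -- each copy's fine-bond sum is the same window sum
  have hcopy : ∀ n : Site (3 + 1), (∑' u : Site (3 + 1), ∑ κ : Fin (3 + 1), dz lam κ u *
          ((1 / 2 : ℝ) • (M2Of 3 L₂ (compMix (ctrOff (3 + 1) Lc) Lc 2) j κ u ρ' (translate M' w n)
            + sgnK (trK (M2Of 3 L₂ (compMix (ctrOff (3 + 1) Lc) Lc 2) j κ u ρ' (translate M' w n))))) x z (Sum.inl α) (Sum.inl γ))
      = ∑ u ∈ Tx, ∑ κ : Fin (3 + 1), dz lam κ u *
          ((1 / 2 : ℝ) • (M2Of 3 L₂ (compMix (ctrOff (3 + 1) Lc) Lc 2) j κ u ρ' (translate M' w n)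
            + sgnK (trK (M2Of 3 L₂ (compMix (ctrOff (3 + 1) Lc) Lc 2) j κ u ρ' (translate M' w n))))) x z (Sum.inl α) (Sum.inl γ) := fun n =>
    tsum_eq_sum fun u hu => Finset.sum_eq_zero fun κ _ => by
      rw [compMixedT2_even_inl_inl_eq_zero_of_not_mem_T L₂ j κ ρ' _ x z α γ u hu, mul_zero]
  simp only [hcopy]
  subst hV
  have hs : ∀ (u : Site (3 + 1)) (κ : Fin (3 + 1)), Summable fun n : Site (3 + 1) => dz lam κ u *
      ((1 / 2 : ℝ) • (M2Of 3 L₂ (compMix (ctrOff (3 + 1) Lc) Lc 2) j κ u ρ' (translate M' w n)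
        + sgnK (trK (M2Of 3 L₂ (compMix (ctrOff (3 + 1) Lc) Lc 2) j κ u ρ' (translate M' w n))))) x z (Sum.inl α) (Sum.inl γ) := fun u κ =>
    (summable_compMixedT2_even_translate_inl_inl (M' := M') L₂ j ρ' w κ u x z α γ).mul_left _
  rw [Summable.tsum_finsetSum fun u _ => summable_sum fun κ _ => hs u κ]
  refine Finset.sum_congr rfl fun u _ => ?_
  rw [Summable.tsum_finsetSum fun κ _ => hs u κ]
  refine Finset.sum_congr rfl fun κ _ => ?_
  rw [← tsum_mul_left]

end Family

/-! ## §3 PART 30 per copy: the lattice contraction of the even composite table with a pure gauge, both storeys written out -/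

section Lattice

variable (L₂ j : ℕ)

/-- [folklore] **THE LATTICE CONTRACTION PER COPY** (PART 30 `CombMixedT2EvenStoreyTwo.tsum_sum_grad_mul_compMixKer_two_even` in the table's letters): for every lattice
function `λ`, coarse bond `(ρ′, y)` and `ff` entry,
`Σ'_u Σ_κ (λ(u+e_κ) − λ u)·M2ᵉ κ u ρ′ y x z (inl α) (inl γ) = wM2 L₂ j · ( Σ_{κ₁e₁κ₂e₂} (λ(Lc•(Lc•y+e₂)+ρ_c) − λ(Lc•(Lc•y+e₁)+ρ_c))·h(ρ′,y;b₁,b₂)·ℓ(b₁;(α,x))·ℓ(b₂;(γ,z))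
 + (λ z − λ x)·Σ_{κ,e} ℓ(ρ′,y;b)·h(b;(α,x),(γ,z)) )` (`b = (κ, Lc•y+e)`): top storey's ROOT-sampled commutator between the transports + lower storey's finest one. -/
theorem tsum_sum_dz_mul_compMixedT2_even_inl_inl (lam : Site (3 + 1) → ℝ) (ρ' : Fin (3 + 1)) (y x z : Site (3 + 1)) (α γ : Fin (3 + 1)) :
    ∑' u : Site (3 + 1), ∑ κ : Fin (3 + 1), dz lam κ u *
        ((1 / 2 : ℝ) • (M2Of 3 L₂ (compMix (ctrOff (3 + 1) Lc) Lc 2) j κ u ρ' y + sgnK (trK (M2Of 3 L₂ (compMix (ctrOff (3 + 1) Lc) Lc 2) j κ u ρ' y)))) x z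
          (Sum.inl α) (Sum.inl γ)
      = wM2 3 L₂ j * ((∑ κ₁ : Fin (3 + 1), ∑ e₁ ∈ offs Lc, ∑ κ₂ : Fin (3 + 1), ∑ e₂ ∈ offs Lc,
          (lam ((Lc : ℤ) • ((Lc : ℤ) • y + e₂) + ctr 4 Lc) - lam ((Lc : ℤ) • ((Lc : ℤ) • y + e₁) + ctr 4 Lc))
            * symHessKerAt (ctr 4 Lc) Lc ρ' y (κ₁, (Lc : ℤ) • y + e₁) (κ₂, (Lc : ℤ) • y + e₂)
            * symLinKerAt (ctr 4 Lc) Lc κ₁ ((Lc : ℤ) • y + e₁) (α, x) * symLinKerAt (ctr 4 Lc) Lc κ₂ ((Lc : ℤ) • y + e₂) (γ, z))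
        + (lam z - lam x) * ∑ κ : Fin (3 + 1), ∑ e ∈ offs Lc,
            symLinKerAt (ctr 4 Lc) Lc ρ' y (κ, (Lc : ℤ) • y + e) * symHessKerAt (ctr 4 Lc) Lc κ ((Lc : ℤ) • y + e) (α, x) (γ, z)) := by
  have h30 := tsum_sum_grad_mul_compMixKer_two_even (Lc := Lc) lam ρ' y (α, x) (γ, z)
  rw [← h30, ← tsum_mul_left]
  refine tsum_congr fun u => ?_
  rw [Finset.mul_sum]
  refine Finset.sum_congr rfl fun κ _ => ?_
  rw [compMixedT2_even_inl_inl, compMix_inl_inl, compMix_inl_inl, dz]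
  ring

end Lattice

end Summit.QuantumFields.BalabanUV.Beta.CombMixedT2EvenStoreyTwoPeriodised

end
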